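import Literature.NumberTheory.EllipticCurves.Smith2016.CongruentNumberGenusDeterminantRowSixForest
import Literature.LinearAlgebra.Matrix.AdjugateKernelLine
import Literature.NumberTheory.EllipticCurves.TianYuanZhang2017.RhoIndexMonskyKernelSharp
import Literature.NumberTheory.EllipticCurves.CongruentNumberEvenMonskySelmerExact
import HarnessLib

/-!
# Route `PrintCf2`, crux stmt-BirchSwinnertonDyer-20509 `RamifiedOffTYZOfFacts` — THE SECOND GENUS SUM IS A LINEAR
# FUNCTIONAL OF MONSKY'S KERNEL VECTOR (`n ≡ 6 (mod 8)`, `s(n) = 1`): `Σ₂′(n) ≡ Σ_{pᵢ ≡ 3 (4)} βᵢ (mod 2)`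
# (cell `bsd-print-cf2`, seat p2 «2-descent matrix road», g4; file 1 of 2)

HONEST FRAMING (cell `bsd-print-cf2`, HOME `run/shared/lean/pub/bsd-print-cf2/`; crux 20509 =
`𝔅_ram → WAllCornerFTwoRamifiedOffTYZProved`, OPEN): THEOREMS ONLY — no definition, no named fact, nothing asserted,
nothing booked. The p1 road carved the «TYZ genus class at `ρ = 0`, residue class `6 (mod 8)`» out of the residual as a
flag-free leaf `WAllCornerFTwoRamifiedTYZRhoSix` (`WAll/TargetCMTwoRamifiedRhoSix.lean`, p547613) with the EMPIRICAL
CAVEAT that no member was known (`ρ(n) = 1` in 166/166 determined cases, p2-g2 census j282439). This file supplies the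
MECHANISM that makes the class empty (file 2, `PrintCf2RamifiedOffTYZRhoSixEmpty.lean`, draws the consequence once
cell `bsd-monsky`'s Smith row-6 identity is in the tree): RELATIVE to A. Smith's Theorem 2.2 row 6 in the tree's
currency — the per-tuple hypothesis `hrow6 : Σ₂′(2p₁⋯p_k) ≡ (t;t)ᵀ adj(M₂) (t;t) (mod 2)`, `t = ((−1/pᵢ)₊)`, which
`bsd-monsky` prover-B is landing for every `k` as `Smith2016.genusSum₂'_two_mul_eq_border_adjugate_six` (its halves
`CongruentNumberGenusDeterminantRowSixForest` / `…RowSixBlocks` / `CongruentNumberGenusSumSixDecompositions` are in the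
tree) — the second genus sum of Tian–Yuan–Zhang is the VALUE OF A FIXED LINEAR FORM ON THE SELMER LINE:

* §1 over `𝔽₂`, a SYMMETRIC matrix whose kernel is a line `{0, v}` has `adj(M) = v vᵀ`
  (`adjugate_eq_vecMulVec_of_ker_pair`), hence every bordered determinant `bᵀ adj(M) b = (b·v)² = b·v` is the value
  of the border `b` on the kernel vector (`dotProduct_adjugate_mulVec_of_ker_pair`);
* §2 Monsky's even matrix `M = (Aᵀ + D₂, D₋₁; D₂, A + D₂)` (tree `monskyMatrixEven`) and Smith's symmetric
  `M₂ = (A + Aᵀ + D₋₁ + D₂, Aᵀ; A, D₂)` have kernels in bijection `(β; α) ↦ (α; α + β)`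
  (`smithTwo_mulVec_eq_zero_iff`, `smithTwo_ker_pair`; the congruence `E = (I I; 0 I)` of the tree's
  `conj_fromBlocks_add_transpose_add` followed by a block-column swap, written out on vectors);
* §3 hence for `n = 2p₁⋯p_k` with Monsky kernel `{0, (β; α)}` (`s(n) = 1`):
  **`Σ₂′(n) ≡ t·β = Σ_{pᵢ ≡ 3 (mod 4)} βᵢ (mod 2)`** (`genusSum₂'_eq_dotProduct_beta_of_row6`, since
  `(t;t)·(α; α+β) = t·β`); so `Σ₂′(n)` odd ⟹ `β ≠ 0` (`beta_ne_zero_of_odd_genusSum₂'_of_row6`) ⟹ with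
  `Ш(E_n)[2^∞] = 0`, by the sharpness theorem `rhoIndex_ne_one_of_kernelVector_even` (p548589): **`ρ(n) ≥ 1`**
  (`rhoIndex_ne_one_of_odd_genusSum₂'_of_row6`) — uniformly in `k`. Tian's class 6 (`2p₀∏pᵢ`, `p₀ ≡ 3 (4)`,
  `pᵢ ≡ 1 (8)`, kernel `(𝟙;𝟙)`/`(𝟙;0)`, `Tian2014.card_ker_monskyMatrixEven_caseSix`) is the case `β = 𝟙`, `t·β = 1`.
The identity was checked numerically on all 5 431 square-free `n ≡ 6 (8)`, `n ≤ 6·10⁴`, with `s(n) = 1` before writing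
(seat folder `kit/scanT1`). Consequence for the partition (file 2): on the rank-one leaf `Σ₂′(n)` odd forces `ρ(n) = 1`,
so the `n ≡ 6` clause of TYZ Thm 1.2 AS PRINTED (`ord₂ 𝓛(n) ≤ ρ(n)`) never pins the `2`-part of BSD for an even `n`, and
the flag-free ρ-six leaf books no curve. Beyond print: YES (identity and consequence not in print; Smith's row 6 is a
preprint identity proved in the tree). PARTITION: 0 cells moved.

## References

* [Smith2016CongruentDensity] A. Smith, *The congruent numbers have positive natural density*, arXiv:1603.08479v2,
  §2 Table 2 rows 2 and 6, Thm. 2.2 (source `cnc.tex` l. 100–107), §2.2 (bordered determinants), Prop. 3.2.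
* [HeathBrown1994SelmerCongruentII] D. R. Heath-Brown, Invent. Math. 118 (1994), Appendix (P. Monsky), typescript
  p. 41 L20–L36 (the even matrix `M`, `M₁`, `M₂`; `s(D) = 2Ω(D₀) − rank M`).
* [TianYuanZhang2017] Y. Tian, X. Yuan, S.-W. Zhang, Asian J. Math. 21 (2017) = arXiv:1411.4728, §1 (ρ(n), g(d)),
  Thm. 1.2 (`n ≡ 6` clause).
* [HornJohnson2013] R. A. Horn, C. R. Johnson, *Matrix Analysis*, 2nd ed., §0.8.2 (adjugate of a rank `n − 1` matrix).
* [SilvermanAEC2009] J. H. Silverman, AEC 2nd ed., Thm. X.4.2.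
-/
noncomputable section

open scoped Classical

open Matrix Finset WeierstrassCurve
open Literature.NumberTheory.EllipticCurves
open Literature.NumberTheory.EllipticCurves.HeathBrown1994
open Literature.NumberTheory.EllipticCurves.TianYuanZhang2017
open Literature.NumberTheory.EllipticCurves.TianYuanZhang2017.RhoMonskyKernel
open Literature.NumberTheory.EllipticCurves.Rank1Residual
open Literature.LinearAlgebra.Matrix

set_option autoImplicit false

namespace Summit.BirchSwinnertonDyer.PrintCf2

/-! ## §1 Linear algebra over `𝔽₂`: the adjugate of a symmetric matrix with a two-element kernel -/

section LinAlg

variable {m : Type*} [Fintype m] [DecidableEq m]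

/-- In `𝔽₂` every element is idempotent. [folklore] -/
private theorem zmod_two_mul_self (x : ZMod 2) : x * x = x := by
  revert x; decide

/-- In `𝔽₂`, `x ≠ 0 ↔ x = 1`. [folklore] -/
private theorem zmod_two_ne_zero_iff (x : ZMod 2) : x ≠ 0 ↔ x = 1 := by
  revert x; decide

/-- **The adjugate of a symmetric `𝔽₂`-matrix whose kernel is the line `{0, v}` is `v vᵀ`.** Columns of `adj M`
are kernel vectors (`M · adj M = det M · I = 0`), hence each is `0` or `v`; `adj M ≠ 0` because the nullity is one
(`adjugate_ne_zero_of_vecMul_line`); symmetry pins the pattern down to `vᵢ vⱼ`.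
[cite: HornJohnson2013, §0.8.2 (the adjugate of a matrix of rank n − 1 has rank one; its columns lie in the kernel)] -/
theorem adjugate_eq_vecMulVec_of_ker_pair (M : Matrix m m (ZMod 2)) (hM : Mᵀ = M) {v : m → ZMod 2}
    (hv0 : v ≠ 0) (hv : M *ᵥ v = 0) (hker : ∀ w, M *ᵥ w = 0 → w = 0 ∨ w = v) :
    M.adjugate = vecMulVec v v := by
  have hdet : M.det = 0 := Matrix.exists_mulVec_eq_zero_iff.mp ⟨v, hv0, hv⟩
  -- every column of `adj M` is `0` or `v`
  have hcol : ∀ j, (fun i => M.adjugate i j) = 0 ∨ (fun i => M.adjugate i j) = v :=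
    fun j => hker _ (mulVec_adjugate_col M hdet j)
  -- symmetry of the adjugate
  have hsym : ∀ i j, M.adjugate i j = M.adjugate j i := by
    intro i j
    have h := congrArg (fun N : Matrix m m (ZMod 2) => N j i) (Matrix.adjugate_transpose M)
    simp only [hM, transpose_apply] at h
    exact h
  -- the adjugate is nonzero (nullity one)
  obtain ⟨i₀, hi₀⟩ : ∃ i, v i ≠ 0 := Function.ne_iff.mp hv0
  have hne : M.adjugate ≠ 0 := by
    refine adjugate_ne_zero_of_vecMul_line M v (fun x hx => ?_) i₀
    have hx' : M *ᵥ x = 0 := by rw [← hM, mulVec_transpose]; exact hx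
    rcases hker x hx' with h | h
    · exact ⟨0, by rw [h, zero_smul]⟩
    · exact ⟨1, by rw [h, one_smul]⟩
  -- a column equal to `v`, at an index in the support of `v`
  obtain ⟨j₀, hj₀⟩ : ∃ j, (fun i => M.adjugate i j) = v := by
    obtain ⟨i₁, hi₁⟩ := Function.ne_iff.mp hne
    obtain ⟨j₁, hj₁⟩ := Function.ne_iff.mp hi₁
    refine ⟨j₁, (hcol j₁).resolve_left fun hc => hj₁ ?_⟩
    exact congr_fun hc i₁
  have hi₀1 : v i₀ = 1 := (zmod_two_ne_zero_iff _).mp hi₀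
  have hcol₀ : (fun i => M.adjugate i i₀) = v := by
    rcases hcol i₀ with hc | hc
    · exfalso
      have h1 : M.adjugate i₀ j₀ = v i₀ := congr_fun hj₀ i₀
      have h2 : M.adjugate j₀ i₀ = 0 := congr_fun hc j₀
      rw [hsym, h2] at h1
      exact hi₀ h1.symm
    · exact hc
  ext i j
  rw [vecMulVec_apply]
  have hji : M.adjugate i₀ j = v j := by rw [hsym]; exact congr_fun hcol₀ j
  rcases hcol j with hc | hc
  · have hvj : v j = 0 := by rw [← hji]; exact congr_fun hc i₀
    rw [show M.adjugate i j = 0 from congr_fun hc i, hvj, mul_zero]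
  · have hvj : v j = 1 := by rw [← hji, show M.adjugate i₀ j = v i₀ from congr_fun hc i₀, hi₀1]
    rw [show M.adjugate i j = v i from congr_fun hc i, hvj, mul_one]

/-- **A bordered determinant of a symmetric matrix with kernel `{0, v}` is the value of the border on `v`**:
`bᵀ adj(M) b = (b·v)² = b·v` over `𝔽₂`. [cite: HornJohnson2013, §0.8.2] [cite: Smith2016CongruentDensity, §2.2 (the bordered determinants det (M, u; uᵀ, 0))] -/
theorem dotProduct_adjugate_mulVec_of_ker_pair (M : Matrix m m (ZMod 2)) (hM : Mᵀ = M) {v : m → ZMod 2}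
    (hv0 : v ≠ 0) (hv : M *ᵥ v = 0) (hker : ∀ w, M *ᵥ w = 0 → w = 0 ∨ w = v) (b : m → ZMod 2) :
    b ⬝ᵥ (M.adjugate *ᵥ b) = b ⬝ᵥ v := by
  rw [adjugate_eq_vecMulVec_of_ker_pair M hM hv0 hv hker]
  have h : vecMulVec v v *ᵥ b = (v ⬝ᵥ b) • v := by
    funext i
    simp only [mulVec, dotProduct, vecMulVec_apply, Pi.smul_apply, smul_eq_mul, Finset.sum_mul]
    exact Finset.sum_congr rfl fun j _ => by ring
  rw [h, dotProduct_smul, smul_eq_mul, dotProduct_comm v b, zmod_two_mul_self]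

/-- A two-element kernel `{w : M w = 0}` is a pair `{0, v}` with `v ≠ 0`. [folklore] -/
theorem exists_ker_pair_of_card_eq_two (M : Matrix m m (ZMod 2))
    (h2 : Fintype.card {w : m → ZMod 2 // M *ᵥ w = 0} = 2) :
    ∃ v : m → ZMod 2, v ≠ 0 ∧ M *ᵥ v = 0 ∧ ∀ w, M *ᵥ w = 0 → w = 0 ∨ w = v := by
  have hz : M *ᵥ (0 : m → ZMod 2) = 0 := mulVec_zero M
  rw [← Finset.card_univ] at h2
  obtain ⟨a, b, hab, huniv⟩ := Finset.card_eq_two.mp h2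
  have hmem : ∀ x : {w : m → ZMod 2 // M *ᵥ w = 0}, x = a ∨ x = b := fun x => by
    have hx := Finset.mem_univ x
    rw [huniv, Finset.mem_insert, Finset.mem_singleton] at hx
    exact hx
  rcases hmem ⟨0, hz⟩ with h0 | h0
  · refine ⟨b.1, fun hb => hab ?_, b.2, fun w hw => ?_⟩
    · rw [← h0]; exact Subtype.ext hb.symm
    · rcases hmem ⟨w, hw⟩ with h | h
      · left; have := congrArg Subtype.val h; rw [← h0] at this; exact this
      · right; exact congrArg Subtype.val h
  · refine ⟨a.1, fun ha => hab ?_, a.2, fun w hw => ?_⟩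
    · rw [← h0]; exact (Subtype.ext ha.symm).symm
    · rcases hmem ⟨w, hw⟩ with h | h
      · right; exact congrArg Subtype.val h
      · left; have := congrArg Subtype.val h; rw [← h0] at this; exact this

end LinAlg

/-! ## §2 The dictionary between Monsky's even matrix and Smith's `M₂` -/

section Dictionary

variable {k : ℕ} (p : Fin k → ℕ)

/-- Vectors over `𝔽₂` are `2`-torsion. [folklore] -/
private theorem vec_add_self (u : Fin k → ZMod 2) : u + u = 0 := by
  funext i; exact CharTwo.add_self_eq_zero (u i)

/-- A block vector vanishes iff both blocks vanish. [folklore] -/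
private theorem sumElim_eq_zero_iff (u v : Fin k → ZMod 2) : Sum.elim u v = 0 ↔ u = 0 ∧ v = 0 := by
  constructor
  · intro h
    exact ⟨funext fun i => congr_fun h (Sum.inl i), funext fun i => congr_fun h (Sum.inr i)⟩
  · rintro ⟨hu, hv⟩
    rw [hu, hv]
    exact Sum.elim_zero_zero

/-- **Kernel dictionary `M_even ↔ M₂`.** For Monsky's even matrix `M = (Aᵀ + D₂, D₋₁; D₂, A + D₂)` and Smith's
`M₂ = (A + Aᵀ + (D₋₁ + D₂), Aᵀ; A, D₂)`: `M₂ (α; α + β) = 0 ↔ M (β; α) = 0` — the two component equations of `M₂`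
are (sum of the two of `M`; second of `M`). [cite: Smith2016CongruentDensity, §2 Table 2 row 2 (M₂) and §2.2]
[cite: HeathBrown1994SelmerCongruentII, Appendix (Monsky), typescript p. 41 L27–L36 (M, M₁, M₂ of the even case)] -/
theorem smithTwo_mulVec_eq_zero_iff (β α : Fin k → ZMod 2) :
    fromBlocks (legendreMatrix p + (legendreMatrix p)ᵀ + (legendreDiagonal p (-1) + legendreDiagonal p 2))
        (legendreMatrix p)ᵀ (legendreMatrix p) (legendreDiagonal p 2) *ᵥ Sum.elim α (α + β) = 0 ↔
      monskyMatrixEven p *ᵥ Sum.elim β α = 0 := by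
  set A := legendreMatrix p with hA
  set D₂ := legendreDiagonal p 2 with hD₂
  set D₁ := legendreDiagonal p (-1) with hD₁
  have hM : monskyMatrixEven p = fromBlocks (Aᵀ + D₂) D₁ D₂ (A + D₂) := rfl
  rw [hM, fromBlocks_mulVec, fromBlocks_mulVec]
  simp only [Sum.elim_comp_inl, Sum.elim_comp_inr]
  rw [sumElim_eq_zero_iff, sumElim_eq_zero_iff]
  -- name the Monsky components
  set c₁ := (Aᵀ + D₂) *ᵥ β + D₁ *ᵥ α with hc₁
  set c₂ := D₂ *ᵥ β + (A + D₂) *ᵥ α with hc₂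
  have h₂ : A *ᵥ α + D₂ *ᵥ (α + β) = c₂ := by
    rw [hc₂, mulVec_add, add_mulVec]; abel
  have h₁ : (A + Aᵀ + (D₁ + D₂)) *ᵥ α + Aᵀ *ᵥ (α + β) = c₁ + c₂ := by
    rw [hc₁, hc₂, mulVec_add, add_mulVec, add_mulVec, add_mulVec, add_mulVec, add_mulVec]
    have hAA : Aᵀ *ᵥ α + Aᵀ *ᵥ α = 0 := vec_add_self _
    have hDD : D₂ *ᵥ β + D₂ *ᵥ β = 0 := vec_add_self _
    -- rearrange: LHS = Aα + Aᵀα + D₁α + D₂α + Aᵀα + Aᵀβ ; RHS = Aᵀβ + D₂β + D₁α + D₂β + Aα + D₂α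
    calc A *ᵥ α + Aᵀ *ᵥ α + (D₁ *ᵥ α + D₂ *ᵥ α) + (Aᵀ *ᵥ α + Aᵀ *ᵥ β)
        = A *ᵥ α + D₁ *ᵥ α + D₂ *ᵥ α + Aᵀ *ᵥ β + (Aᵀ *ᵥ α + Aᵀ *ᵥ α) := by abel
      _ = A *ᵥ α + D₁ *ᵥ α + D₂ *ᵥ α + Aᵀ *ᵥ β + (D₂ *ᵥ β + D₂ *ᵥ β) := by rw [hAA, hDD]
      _ = Aᵀ *ᵥ β + D₂ *ᵥ β + D₁ *ᵥ α + (D₂ *ᵥ β + (A *ᵥ α + D₂ *ᵥ α)) := by abel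
  rw [h₁, h₂]
  constructor
  · rintro ⟨h12, h2⟩
    refine ⟨?_, h2⟩
    rw [h2, add_zero] at h12
    exact h12
  · rintro ⟨h1, h2⟩
    exact ⟨by rw [h1, h2, add_zero], h2⟩

/-- Smith's `M₂` is symmetric. [cite: Smith2016CongruentDensity, §2 Table 2 row 2] -/
theorem smithTwo_transpose :
    (fromBlocks (legendreMatrix p + (legendreMatrix p)ᵀ + (legendreDiagonal p (-1) + legendreDiagonal p 2))
        (legendreMatrix p)ᵀ (legendreMatrix p) (legendreDiagonal p 2))ᵀ =
      fromBlocks (legendreMatrix p + (legendreMatrix p)ᵀ + (legendreDiagonal p (-1) + legendreDiagonal p 2))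
        (legendreMatrix p)ᵀ (legendreMatrix p) (legendreDiagonal p 2) := by
  rw [fromBlocks_transpose, transpose_transpose]
  congr 1
  · rw [transpose_add, transpose_add, transpose_add, transpose_transpose, legendreDiagonal, legendreDiagonal,
      diagonal_transpose, diagonal_transpose]
    abel
  · rw [legendreDiagonal, diagonal_transpose]

/-- **Kernel-pair transport**: if Monsky's even kernel is `{0, (β₀; α₀)}` then Smith's `M₂`-kernel is
`{0, (α₀; α₀ + β₀)}`. [cite: Smith2016CongruentDensity, §2.2] [cite: HeathBrown1994SelmerCongruentII, Appendix (Monsky), typescript p. 41 L27–L36] -/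
theorem smithTwo_ker_pair {β₀ α₀ : Fin k → ZMod 2} (hv : monskyMatrixEven p *ᵥ Sum.elim β₀ α₀ = 0)
    (hne : Sum.elim β₀ α₀ ≠ 0)
    (hker : ∀ w, monskyMatrixEven p *ᵥ w = 0 → w = 0 ∨ w = Sum.elim β₀ α₀) :
    Sum.elim α₀ (α₀ + β₀) ≠ 0 ∧
    fromBlocks (legendreMatrix p + (legendreMatrix p)ᵀ + (legendreDiagonal p (-1) + legendreDiagonal p 2))
        (legendreMatrix p)ᵀ (legendreMatrix p) (legendreDiagonal p 2) *ᵥ Sum.elim α₀ (α₀ + β₀) = 0 ∧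
    ∀ w, fromBlocks (legendreMatrix p + (legendreMatrix p)ᵀ + (legendreDiagonal p (-1) + legendreDiagonal p 2))
        (legendreMatrix p)ᵀ (legendreMatrix p) (legendreDiagonal p 2) *ᵥ w = 0 →
      w = 0 ∨ w = Sum.elim α₀ (α₀ + β₀) := by
  refine ⟨fun h => hne ?_, (smithTwo_mulVec_eq_zero_iff p β₀ α₀).mpr hv, fun w hw => ?_⟩
  · obtain ⟨ha, hab⟩ := (sumElim_eq_zero_iff _ _).mp h
    have hb : β₀ = 0 := by
      have := hab; rw [ha, zero_add] at this; exact this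
    rw [ha, hb]; exact Sum.elim_zero_zero
  · -- write `w = (a; b)` and set `α = a`, `β = a + b`
    set a : Fin k → ZMod 2 := w ∘ Sum.inl with ha
    set b : Fin k → ZMod 2 := w ∘ Sum.inr with hb
    have hw' : w = Sum.elim a (a + (a + b)) := by
      rw [← add_assoc, vec_add_self, zero_add, ha, hb, Sum.elim_comp_inl_inr]
    rw [hw'] at hw ⊢
    have hM := (smithTwo_mulVec_eq_zero_iff p (a + b) a).mp hw
    rcases hker _ hM with h | h
    · left
      obtain ⟨hab, ha0⟩ := (sumElim_eq_zero_iff _ _).mp h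
      rw [ha0, zero_add] at hab
      rw [ha0, hab]
      simp only [add_zero]
      exact Sum.elim_zero_zero
    · right
      have h1 : a + b = β₀ := by
        have := congrArg (fun f => f ∘ Sum.inl) h; simpa using this
      have h2 : a = α₀ := by
        have := congrArg (fun f => f ∘ Sum.inr) h; simpa using this
      rw [h1, h2]

end Dictionary

/-! ## §3 The second genus sum as a linear functional of Monsky's kernel vector (`s(n) = 1`) -/

section GenusFunctional

variable {k : ℕ} (p : Fin k → ℕ)

/-- **`Σ₂′(2p₁⋯p_k) ≡ Σ_{pᵢ ≡ 3 (mod 4)} βᵢ (mod 2)`** when Monsky's even kernel is the pair `{0, (β; α)}` — relative to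
Smith's Theorem 2.2 row 6 in the tree's currency (`hrow6`: `Σ₂′ ≡ (t;t)ᵀ adj(M₂) (t;t)`, `t = ((−1/pᵢ)₊)`, being landed by
cell `bsd-monsky` as `Smith2016.genusSum₂'_two_mul_eq_border_adjugate_six`). Proof: `adj(M₂) = v vᵀ` for the Smith
kernel vector `v = (α; α + β)` (§1–§2), and `(t;t)·(α; α+β) = t·β`.
[cite: Smith2016CongruentDensity, Thm. 2.2 row 6 / Table 2 (source cnc.tex l. 100–107), §2.2, Prop. 3.2]
[cite: TianYuanZhang2017, Thm. 1.2 (n ≡ 6 clause: the sum Σ₂′)] [cite: HornJohnson2013, §0.8.2] -/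
theorem genusSum₂'_eq_dotProduct_beta_of_row6
    (hrow6 : ((genusSum₂' (2 * ∏ i, p i) (fun d => genusClassNumber (GenusField d)) : ℕ) : ZMod 2) =
      Sum.elim (fun i => addLegendreSym (-1) (p i)) (fun i => addLegendreSym (-1) (p i)) ⬝ᵥ
        ((fromBlocks (legendreMatrix p + (legendreMatrix p)ᵀ + (legendreDiagonal p (-1) + legendreDiagonal p 2))
            (legendreMatrix p)ᵀ (legendreMatrix p) (legendreDiagonal p 2)).adjugate *ᵥ
          Sum.elim (fun i => addLegendreSym (-1) (p i)) (fun i => addLegendreSym (-1) (p i))))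
    {β₀ α₀ : Fin k → ZMod 2} (hv : monskyMatrixEven p *ᵥ Sum.elim β₀ α₀ = 0) (hne : Sum.elim β₀ α₀ ≠ 0)
    (hker : ∀ w, monskyMatrixEven p *ᵥ w = 0 → w = 0 ∨ w = Sum.elim β₀ α₀) :
    ((genusSum₂' (2 * ∏ i, p i) (fun d => genusClassNumber (GenusField d)) : ℕ) : ZMod 2) =
      (fun i => addLegendreSym (-1) (p i)) ⬝ᵥ β₀ := by
  obtain ⟨hne', hv', hker'⟩ := smithTwo_ker_pair p hv hne hker
  rw [hrow6, dotProduct_adjugate_mulVec_of_ker_pair _ (smithTwo_transpose p) hne' hv' hker',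
    sumElim_dotProduct_sumElim, dotProduct_add]
  have h : (fun i => addLegendreSym (-1) (p i)) ⬝ᵥ α₀ + (fun i => addLegendreSym (-1) (p i)) ⬝ᵥ α₀ = 0 :=
    CharTwo.add_self_eq_zero _
  rw [← add_assoc, h, zero_add]

/-- **`Σ₂′(n)` odd ⟹ `β ≠ 0`** for the Monsky kernel vector `(β; α)` (`s(n) = 1`), relative to `hrow6`.
[cite: Smith2016CongruentDensity, Thm. 2.2 row 6 and Prop. 3.2] [cite: TianYuanZhang2017, Thm. 1.2] -/
theorem beta_ne_zero_of_odd_genusSum₂'_of_row6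
    (hrow6 : ((genusSum₂' (2 * ∏ i, p i) (fun d => genusClassNumber (GenusField d)) : ℕ) : ZMod 2) =
      Sum.elim (fun i => addLegendreSym (-1) (p i)) (fun i => addLegendreSym (-1) (p i)) ⬝ᵥ
        ((fromBlocks (legendreMatrix p + (legendreMatrix p)ᵀ + (legendreDiagonal p (-1) + legendreDiagonal p 2))
            (legendreMatrix p)ᵀ (legendreMatrix p) (legendreDiagonal p 2)).adjugate *ᵥ
          Sum.elim (fun i => addLegendreSym (-1) (p i)) (fun i => addLegendreSym (-1) (p i))))
    {β₀ α₀ : Fin k → ZMod 2} (hv : monskyMatrixEven p *ᵥ Sum.elim β₀ α₀ = 0) (hne : Sum.elim β₀ α₀ ≠ 0)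
    (hker : ∀ w, monskyMatrixEven p *ᵥ w = 0 → w = 0 ∨ w = Sum.elim β₀ α₀)
    (hgen : Odd (genusSum₂' (2 * ∏ i, p i) fun d => genusClassNumber (GenusField d))) : β₀ ≠ 0 := by
  intro hβ
  have h := genusSum₂'_eq_dotProduct_beta_of_row6 p hrow6 hv hne hker
  have h1 : ((genusSum₂' (2 * ∏ i, p i) (fun d => genusClassNumber (GenusField d)) : ℕ) : ZMod 2) = 1 :=
    ZMod.natCast_eq_one_iff_odd.mpr hgen
  rw [hβ, dotProduct_zero, h1] at h
  exact one_ne_zero h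

/-- **THE UNIFORM ρ-THEOREM (every `k`).** `n = 2p₁⋯p_k` (distinct odd primes), `s(n) = 1` (Monsky's even kernel has
two elements), `Σ₂′(n)` odd, and `Ш(E_n)[2^∞] = 0`: then `ρ(n) ≥ 1`, i.e. `[E_n(ℚ) : φ_n(A_n(ℚ)) + E_n[2]] ≠ 1` —
relative to `hrow6` (Smith Thm 2.2 row 6). The kernel vector has `β ≠ 0` (§3) and sharpness
(`rhoIndex_ne_one_of_kernelVector_even`) turns the Selmer class into a rational point outside `φ(A(ℚ)) + E[2]`.
[cite: TianYuanZhang2017, §1 (definition of ρ(n)) and Thm. 1.2 (n ≡ 6 clause)]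
[cite: Smith2016CongruentDensity, Thm. 2.2 row 6, Prop. 3.2] [cite: SilvermanAEC2009, Thm. X.4.2] -/
theorem rhoIndex_ne_one_of_odd_genusSum₂'_of_row6 (hp : ∀ i, (p i).Prime) (hp2 : ∀ i, p i ≠ 2)
    (hinj : Function.Injective p)
    (hrow6 : ((genusSum₂' (2 * ∏ i, p i) (fun d => genusClassNumber (GenusField d)) : ℕ) : ZMod 2) =
      Sum.elim (fun i => addLegendreSym (-1) (p i)) (fun i => addLegendreSym (-1) (p i)) ⬝ᵥ
        ((fromBlocks (legendreMatrix p + (legendreMatrix p)ᵀ + (legendreDiagonal p (-1) + legendreDiagonal p 2))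
            (legendreMatrix p)ᵀ (legendreMatrix p) (legendreDiagonal p 2)).adjugate *ᵥ
          Sum.elim (fun i => addLegendreSym (-1) (p i)) (fun i => addLegendreSym (-1) (p i))))
    (hker : Fintype.card {v : Fin k ⊕ Fin k → ZMod 2 // monskyMatrixEven p *ᵥ v = 0} = 2)
    (hgen : Odd (genusSum₂' (2 * ∏ i, p i) fun d => genusClassNumber (GenusField d)))
    (hsha : haveI := isElliptic_congruentNumberCurve
                (mul_ne_zero two_ne_zero (Finset.prod_ne_zero_iff.mpr fun i _ => (hp i).ne_zero));
      AddCommGroup.primaryComponent (congruentNumberCurve (2 * ∏ i, p i)).sha 2 = ⊥)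
    {n : ℕ} (hn : 2 * ∏ i, p i = n) : (rhoSubgroup n).index ≠ 1 := by
  obtain ⟨v, hv0, hv, hkp⟩ := exists_ker_pair_of_card_eq_two _ hker
  have hvs : v = Sum.elim (v ∘ Sum.inl) (v ∘ Sum.inr) := (Sum.elim_comp_inl_inr v).symm
  rw [hvs] at hv0 hv hkp
  have hβ := beta_ne_zero_of_odd_genusSum₂'_of_row6 p hrow6 hv hv0 hkp hgen
  exact rhoIndex_ne_one_of_kernelVector_even hp hp2 hinj hv hβ hsha hn

end GenusFunctional

end Summit.BirchSwinnertonDyer.PrintCf2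

end
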